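import Summits.QuantumFields.BalabanUV.T4Continuum.Spine.NE3.FrameNormalisationOneLevel
import HarnessLib

/-!
# T⁴ programme, node NE3 — census R50 open half (M1), FOURTEENTH BRICK: the `δ`-TWISTED block frames are UNITARY (so the twisted tower stays in `U(n)`) — the twisted analogue of
# [Balaban1985RegularSpaces] Prop. 7's `B8Prop7AdmittedFamily.wframe_mem_unitaryUnits` (`FrameNormalisationTwistedFrameUnitary`)

Cell `pub-balaban-gaps` (track G2, seat ne3, generation 11), row NE3; census `HOME/ne/NE3.md` §4 R50, §17 (M1).  Bricks 10 and 13 (`FrameNormalisationTowerError`, `…TowerSize`) and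
the Lipschitz bricks take the twisted block frames `w′ʲ(y) = exp Σ_r L^{−d} log[T_r·a_r]` (`T_r` twisted holonomies, `a_r = δ_v(y,Γ_r)⁻¹` the inverse covariant block oscillations)
to be units of norm `≤ 1`.  They are in fact UNITARY whenever the data are: the logarithm of a unitary within `1∕4` of `1` is skew-adjoint ((22)–(23); `B7Prop2Explicit.star_mlog_eq_neg`),
real combinations of skew-adjoint elements are skew-adjoint, and `exp` of a skew-adjoint element is unitary (Mathlib `NormedSpace.exp_mem_unitary_of_mem_skewAdjoint`):

* **`expUnit_sum_smul_mlog_mem_unitaryUnits`** — abstract: units `u_r ∈ U(n)` with `‖u_r − 1‖ ≤ 1∕4`, real weights `c_r` ⟹ `exp(Σ_r c_r • log u_r) ∈ U(n)`.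
* `covOsc_mem_unitaryUnits` — `δ_v(y,Γ) = v(y)⁻¹·R(V₀(Γ))v(y + disp Γ)` is unitary for unitary `V₀`, `v`.
* **`twistedFrame_mem_unitaryUnits`** — for unitary `V₀`, `V₁`, `v` with `‖(R_{0,y}V₁)(Γ_r)·δ_v(y,Γ_r)⁻¹ − 1‖ ≤ 1∕4` on the block: the `δ`-twisted frame of
  `FrameNormalisationDefect` ∕ `…TowerExists` at `y` is unitary.

HONEST FRAMING (page 1).  Elementary (0 def, 0 sorry); nothing of Bałaban's asserted; **NE3 NOT proved**; `PairLandauGaugeB8Avg` and the covariant root NOT proved; spine PROVED 0∕9; finite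
T⁴ rung (B)+1 — NOT continuum YM on ℝ⁴, NOT infinite volume, NOT mass gap, NOT `BetaPertH`, NOT Clay.  HONEST DEPENDENCY: continuum YM on T⁴ ⇐ BetaPertH ∧ nine spine estimates (0/9
proved); BetaPertH ⇐ (D1) ∧ (D4) ∧ CAP+tail; G-an2-4 gates asym, D1 and NE2/3/4.  PLACEMENT: `Summits/QuantumFields/BalabanUV/T4Continuum/Spine/NE3/`; imports `FrameNormalisationOneLevel` only.

References: [Balaban1985Averaging] T. Bałaban, *Averaging operations for lattice gauge theories*, CMP 98 (1985) 17–51: (22)–(23) p. 21, (58) p. 27, (82) p. 30;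
[Balaban1985RegularSpaces] CMP 99 (1985), Prop. 7 p. 94.
-/

set_option autoImplicit false

open scoped BigOperators Matrix Matrix.Norms.L2Operator
open NormedSpace

namespace Summit.QuantumFields.BalabanUV.T4Continuum.NE3.FrameNormalisationTwistedFrameUnitary

open Literature.MathematicalPhysics.QuantumFieldTheory.Balaban1983to89
open B7Prop1Explicit B7Prop2Explicit MatrixLog
open B7Eq92Concrete (Rc Rc_apply tHol)

noncomputable section

variable {d : ℕ} {n : Type*} [Fintype n] [DecidableEq n]

/-- **`exp(Σ_r c_r • log u_r)` IS UNITARY** for unitary `u_r` within `1∕4` of `1` and real weights `c_r` (skew-adjoint logarithms, (22)–(23)). [folklore] -/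
theorem expUnit_sum_smul_mlog_mem_unitaryUnits [Nonempty n] {ι : Type*} (s : Finset ι) (c : ι → ℝ) (u : ι → (Matrix n n ℂ)ˣ)
    (hu : ∀ r ∈ s, u r ∈ unitaryUnits (Matrix n n ℂ)) (hsmall : ∀ r ∈ s, ‖((u r : (Matrix n n ℂ)ˣ) : Matrix n n ℂ) - 1‖ ≤ 1 / 4) :
    expUnit (∑ r ∈ s, (c r) • mlog ((u r : (Matrix n n ℂ)ˣ) : Matrix n n ℂ)) ∈ unitaryUnits (Matrix n n ℂ) := by
  letI : CStarAlgebra (Matrix n n ℂ) := {}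
  letI : NormedAlgebra ℚ (Matrix n n ℂ) := NormedAlgebra.restrictScalars ℚ ℂ (Matrix n n ℂ)
  have hF : (∑ r ∈ s, (c r) • mlog ((u r : (Matrix n n ℂ)ˣ) : Matrix n n ℂ)) ∈ skewAdjoint (Matrix n n ℂ) := by
    refine sum_mem fun r hr => skewAdjoint.smul_mem _ ?_
    rw [skewAdjoint.mem_iff]
    exact star_mlog_eq_neg ((mem_unitaryUnits).1 (hu r hr)) (hsmall r hr)
  rw [mem_unitaryUnits, val_expUnit]
  exact NormedSpace.exp_mem_unitary_of_mem_skewAdjoint hF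

/-- The covariant block oscillation `δ_v(y,Γ) = v(y)⁻¹·R(V₀(Γ))v(y + disp Γ)` is unitary for unitary `V₀`, `v` (hence so is its inverse). [folklore] -/
theorem covOsc_mem_unitaryUnits [Nonempty n] {V₀ : Site d → Fin d → (Matrix n n ℂ)ˣ} {v : Site d → (Matrix n n ℂ)ˣ}
    (hV₀ : ∀ (x : Site d) (κ : Fin d), V₀ x κ ∈ unitaryUnits (Matrix n n ℂ)) (hv : ∀ x : Site d, v x ∈ unitaryUnits (Matrix n n ℂ))
    (y : Site d) (w : List (Letter d)) :
    (v y)⁻¹ * Rc (hol V₀ y w) (v (y + disp w)) ∈ unitaryUnits (Matrix n n ℂ) := by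
  letI : CStarAlgebra (Matrix n n ℂ) := {}
  rw [Rc_apply]
  have hh := hol_mem_of hV₀ y w
  exact (unitaryUnits _).mul_mem ((unitaryUnits _).inv_mem (hv y))
    ((unitaryUnits _).mul_mem ((unitaryUnits _).mul_mem hh (hv _)) ((unitaryUnits _).inv_mem hh))

/-- **THE `δ`-TWISTED BLOCK FRAME IS UNITARY**: for unitary `V₀`, `V₁`, `v` with every twisted-and-twisted-back holonomy `(R_{0,y}V₁)(Γ_r)·δ_v(y,Γ_r)⁻¹` within `1∕4` of `1`,
`exp Σ_r L^{−d} log[(R_{0,y}V₁)(Γ_r)·δ_v(y,Γ_r)⁻¹] ∈ U(n)` — the hypothesis `w′ʲ(y) ∈ U(n)` ∕ `‖w′ʲ(y)‖ ≤ 1` of bricks 10∕13 and of the Lipschitz bricks, discharged. [folklore] -/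
theorem twistedFrame_mem_unitaryUnits [Nonempty n] (L : ℕ) {V₀ V₁ : Site d → Fin d → (Matrix n n ℂ)ˣ} {v : Site d → (Matrix n n ℂ)ˣ}
    (hV₀ : ∀ (x : Site d) (κ : Fin d), V₀ x κ ∈ unitaryUnits (Matrix n n ℂ)) (hV₁ : ∀ (x : Site d) (κ : Fin d), V₁ x κ ∈ unitaryUnits (Matrix n n ℂ))
    (hv : ∀ x : Site d, v x ∈ unitaryUnits (Matrix n n ℂ)) (y : Site d)
    (hsmall : ∀ r : Fin d → Fin L,
      ‖(((tHol V₀ V₁ y (treeWord (boxVec L r)) *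
          ((v y)⁻¹ * Rc (hol V₀ y (treeWord (boxVec L r))) (v (y + boxVec L r)))⁻¹ : (Matrix n n ℂ)ˣ)) : Matrix n n ℂ) - 1‖ ≤ 1 / 4) :
    expUnit (∑ r : Fin d → Fin L, (((L : ℝ) ^ d)⁻¹) •
        mlog ((tHol V₀ V₁ y (treeWord (boxVec L r)) *
          ((v y)⁻¹ * Rc (hol V₀ y (treeWord (boxVec L r))) (v (y + boxVec L r)))⁻¹ : (Matrix n n ℂ)ˣ) : Matrix n n ℂ))
      ∈ unitaryUnits (Matrix n n ℂ) := by
  letI : CStarAlgebra (Matrix n n ℂ) := {}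
  refine expUnit_sum_smul_mlog_mem_unitaryUnits Finset.univ (fun _ => ((L : ℝ) ^ d)⁻¹)
    (fun r => tHol V₀ V₁ y (treeWord (boxVec L r)) * ((v y)⁻¹ * Rc (hol V₀ y (treeWord (boxVec L r))) (v (y + boxVec L r)))⁻¹)
    (fun r _ => ?_) (fun r _ => hsmall r)
  have hT : tHol V₀ V₁ y (treeWord (boxVec L r)) ∈ unitaryUnits (Matrix n n ℂ) := by
    unfold tHol
    refine (unitaryUnits _).mul_mem (hol_mem_of (fun x κ => ?_) y _) ((unitaryUnits _).inv_mem (hol_mem_of hV₀ y _))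
    rw [Pi.mul_apply]
    exact (unitaryUnits _).mul_mem (hV₁ x κ) (hV₀ x κ)
  have hδ := covOsc_mem_unitaryUnits hV₀ hv y (treeWord (boxVec L r))
  rw [disp_treeWord] at hδ
  exact (unitaryUnits _).mul_mem hT ((unitaryUnits _).inv_mem hδ)

end

end Summit.QuantumFields.BalabanUV.T4Continuum.NE3.FrameNormalisationTwistedFrameUnitary
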